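import Mathlib.Probability.ProbabilityMassFunction.Constructions
import Mathlib.Topology.Algebra.InfiniteSum.ENNReal
import Mathlib.Analysis.SpecialFunctions.Pow.Real
import Literature.Computability.Complexity.TimeBounds
import Literature.Computability.Complexity.BoolEncodings
import Literature.Computability.Complexity.Classes
import Literature.Computability.Complexity.Nondeterministic
import Literature.Computability.Complexity.Randomized
import HarnessLib

-- provenance: harness21/H21/H21/Prelude/CplxMeta/DistProblems.lean @ 06ba227 (interim HEAD d8f2665); M5 mechanical rewrite
/-!
# Complexity meta: distributional problems and average-case classes

Trunk `CplxMeta` (G14), concept C11 (`DistProblems`; realises the deterministic part of the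
notion `distributional_problems_avgP`; outline D4).

A *distributional problem* is a pair `(L, D)` of a language `L ⊆ {0,1}*` and an *ensemble*
`D = (Dₙ)ₙ` of distributions on bit strings (`Ensemble := ℕ → PMF (List Bool)`). We define

* `Ensemble.prob`, `uniformEnsemble` (uniform on `{0,1}ⁿ`), `Ensemble.HasPolyLength`
  (Bogdanov–Trevisan's standing assumption `|x| ≤ poly(n)` on `supp Dₙ`),
  `Ensemble.IsPolySamplable` / `PSamp` (exact polynomial-time samplers, via G01's `RandAlg`);
* `DistProblem`, `distClass C 𝒟 = {(L, D) | L ∈ C, D ∈ 𝒟}`, `DistNP = (NP, PSamp)`;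
* the errorless classes `AvgDeltaP δ`, `AvgP` (errorless heuristic *schemes*: the algorithm
  receives `(x, 1ⁿ, 1ᵐ)` and may answer `⊥ = none` with probability `≤ δ = 1/m`) and the
  heuristic classes `HeurDeltaP δ`, `HeurP` (may err instead of answering `⊥`);
* Levin's original "polynomial on average" running time `Ensemble.IsPolyOnAverage`
  (`∃ ε > 0, 𝔼_{x ∼ Dₙ}[t(x,n)^ε] = O(n)`) and the class `AvgPLevin`, linked to `AvgP` by the
  known theorem `mem_AvgP_iff_mem_AvgPLevin` (under `HasPolyLength`).

## Design choices

* **`AvgP` is defined by errorless heuristic schemes** (Bogdanov–Trevisan 2006, Def. 2.4 /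
  Prop. 2.6 – Impagliazzo 1995 §2), i.e. by BT's *characterisation* of Levin's class; Levin's
  `𝔼[t^ε] = O(n)` form is the separate predicate `Ensemble.IsPolyOnAverage` and the equivalence
  is a `sorry`d theorem (theorem-as-definition, like G01's `ZPP`).
* The error parameter `δ` of a scheme is passed in unary as `1ᵐ`, `δ = 1/m` (`schemeEnc`), so
  "time polynomial in `n/δ`" (BT) becomes "time polynomial in the input length
  `|schemeEnc (x, n, m)| = 2|x| + 2n + m + 4`". The two agree exactly for ensembles with
  `HasPolyLength` (in particular for all of `PSamp`), which is BT's standing assumption.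
* `Ensemble.IsPolyOnAverage` sums in `ℝ≥0∞`: a divergent series is `⊤` there and fails the
  bound, whereas a real-valued `tsum` of a non-summable family is the junk value `0`
  (`tsum_eq_zero_of_not_summable`), which would make every slow machine "polynomial on average".
* `AvgPLevin` demands halting with the correct answer only on the **support** of `Dₙ` (as Levin
  and BT implicitly do: the running time off-support has weight `0`). Demanding it everywhere
  would exclude `AvgP` problems whose language is undecidable off the support.
* Likewise, *errorlessness* (`IsErrorlessFor A Q`) is required on `supp Dₙ` only, verbatim as in
  Bogdanov–Trevisan Def. 2.4 ("for every `n` and every `x ∈ supp Dₙ`, `A(x; n) ∈ {L(x), ⊥}`").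
  A global (all-`x`) errorlessness condition would make `AvgP` strictly smaller than BT's class
  and break `mem_AvgP_iff_mem_AvgPLevin` (P-immune point-mass ensembles give counterexamples).
* The parameter `δ : ℕ → ℝ` of `AvgDeltaP δ` / `HeurDeltaP δ` is unconstrained, as in BT: for
  `δ n < 0` the defining condition at `n` is unsatisfiable and for `δ n ≥ 1` it is void.
* Samplers are *exact* (`outputPMF = Dₙ`), BT Def. 2.1's `PSamp`; Levin's P-computable
  ensembles `PComp` are omitted (no target statement needs them; Impagliazzo–Levin 1990).
* Universes: everything is over `Bool`/`List Bool` (`Type`), as in G01. Distributional problems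
  are called `Q` (`Π` is a Lean token). `noncomputable` is confined to declarations mentioning
  `Set.boolIndicator` / `ENNReal.toReal`.

Mathlib anchors used (not redefined): `PMF`, `PMF.map`, `PMF.support`, `PMF.toOuterMeasure`,
`PMF.uniformOfFintype`, `List.Vector`, `ENNReal.ofReal`, `Real.rpow`, `tsum`,
`Computability.unaryEncodeNat`, `Computability.encodeBool`, `Computability.encodingBoolBool`,
`Set.boolIndicator`. Mathlib has no distributional problems / average-case classes (grep:
no `DistNP`, `AvgP`, `Samplable`). H21 anchors: `RandAlg`, `RandAlg.outputPMF`,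
`RandAlg.IsPolyTime`, `uniformProb`, `PolyTimeComputable`, `TM2ComputableAux.OutputsWithin`,
`boolPair`, `Encoding.optionBool`, `P`, `NP`.

## References

* L. Levin, *Average case complete problems*, SIAM J. Comput. 15 (1986), 285–286.
* A. Bogdanov, L. Trevisan, *Average-Case Complexity*, Found. Trends TCS 2 (2006), Ch. 2
  (Def. 2.1 `PSamp`, Def. 2.2 average polynomial time, Def. 2.4 errorless heuristic schemes,
  Prop. 2.6, Def. 2.7 `AvgδP`, Def. 2.9–2.10 `HeurP`/`HeurδP`, §2.1 `|x| ≤ poly(n)`), Ch. 3.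
* R. Impagliazzo, *A personal view of average-case complexity*, CCC 1995, §2.
* R. Impagliazzo, L. Levin, *No better ways to generate hard NP instances than picking uniformly
  at random*, FOCS 1990.
-/

namespace Literature.Computability.MetaComplexity

open _root_.Computability Complexity Complexity.Classes Complexity.Nondeterministic
open scoped ENNReal

/-! ### Ensembles of distributions -/

/-- An *ensemble* of distributions on bit strings: for every parameter `n : ℕ` a probability
mass function `Dₙ` on `{0,1}*` (Mathlib `PMF`). [Bogdanov–Trevisan 2006, §1.1/§2.1
("ensemble `D = {Dₙ}`"); Levin 1986] [cite: BogdanovTrevisan2006, §1.1/§2.1 ("ensemble  D = {Dₙ} "] -/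
abbrev Ensemble : Type := ℕ → PMF (List Bool)

namespace Ensemble

/-- `D.prob n E`: the probability `Pr_{x ∼ Dₙ}[x ∈ E] ∈ [0,1]` of the event `E ⊆ {0,1}*` under
the `n`-th distribution, as a real number (`.toReal` of Mathlib's `PMF.toOuterMeasure`, which
is finite). [Bogdanov–Trevisan 2006, §2.1; Mathlib `PMF.toOuterMeasure`] [cite: BogdanovTrevisan2006, §2.1] -/
noncomputable def prob (D : Ensemble) (n : ℕ) (E : Set (List Bool)) : ℝ :=
  ((D n).toOuterMeasure E).toReal

/-- Probabilities are nonnegative. [Mathlib `ENNReal.toReal_nonneg`] [folklore] -/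
theorem prob_nonneg (D : Ensemble) (n : ℕ) (E : Set (List Bool)) : 0 ≤ D.prob n E :=
  ENNReal.toReal_nonneg

/-- Probabilities are at most `1`. [Mathlib `PMF.toOuterMeasure_apply_eq_one_iff`] [folklore] -/
theorem prob_le_one (D : Ensemble) (n : ℕ) (E : Set (List Bool)) : D.prob n E ≤ 1 := by
  unfold prob
  have h : (D n).toOuterMeasure E ≤ (D n).toOuterMeasure Set.univ :=
    PMF.toOuterMeasure_mono _ (Set.subset_univ _)
  rw [(PMF.toOuterMeasure_apply_eq_one_iff _ _).2 (Set.subset_univ _)] at h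
  simpa using ENNReal.toReal_mono ENNReal.one_ne_top h

/-- `D.HasPolyLength`: the strings in the support of `Dₙ` have length at most `p(n)` for some
polynomial `p`. This is Bogdanov–Trevisan's standing convention (§2.1: "we assume `|x| ≤
poly(n)` for `x` in the support of `Dₙ`"); every polynomial-time samplable ensemble has it
(`IsPolySamplable.hasPolyLength`). It is the hypothesis under which "polynomial in the encoded
input `(x, 1ⁿ, 1ᵐ)`" and "polynomial in `n/δ`" coincide. [Bogdanov–Trevisan 2006, §2.1] [cite: BogdanovTrevisan2006, §2.1] -/
def HasPolyLength (D : Ensemble) : Prop :=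
  ∃ p : Polynomial ℕ, ∀ n, ∀ x ∈ (D n).support, x.length ≤ p.eval n

/-- `D.IsPolySamplable`: `D` is (exactly) polynomial-time samplable — there is a probabilistic
polynomial-time algorithm `A` (G01 `RandAlg`, input `1ⁿ` via `unaryEncodeNat`) whose output
distribution on `1ⁿ` is exactly `Dₙ`. [Bogdanov–Trevisan 2006, Def. 2.1 (`PSamp`, exact
version); Ben-David–Chor–Goldreich–Luby 1992, §3] [cite: BogdanovTrevisan2006, Def. 2.1 ( PSamp   exact version] -/
def IsPolySamplable (D : Ensemble) : Prop :=
  ∃ A : RandAlg ℕ (List Bool), A.IsPolyTime unaryEncodeNat id ∧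
    ∀ n, A.outputPMF unaryEncodeNat n = D n

/-- Levin's "polynomial on average" running time for a time function `T x n` w.r.t. the
ensemble `D`: there are `ε > 0` and `c` with `𝔼_{x ∼ Dₙ}[T(x,n)^ε] ≤ c·n + c` for all `n`.
The expectation is an `ℝ≥0∞`-valued `tsum`, so a divergent series is `⊤` and violates the
bound; a real-valued `tsum` would instead return the junk value `0` for non-summable families
(Mathlib `tsum_eq_zero_of_not_summable`) and make the predicate vacuous.
[Levin 1986; Bogdanov–Trevisan 2006, Def. 2.2; Impagliazzo 1995, §2.2] [cite: Levin1986] -/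
def IsPolyOnAverage (D : Ensemble) (T : List Bool → ℕ → ℕ) : Prop :=
  ∃ ε : ℝ, 0 < ε ∧ ∃ c : ℕ, ∀ n,
    ∑' x, D n x * ENNReal.ofReal ((T x n : ℝ) ^ ε) ≤ ((c * n + c : ℕ) : ℝ≥0∞)

end Ensemble

/-- The uniform ensemble `U = (Uₙ)ₙ`, `Uₙ` uniform on `{0,1}ⁿ`: the push-forward along
`List.Vector.toList` of Mathlib's `PMF.uniformOfFintype (List.Vector Bool n)`.
[Bogdanov–Trevisan 2006, §1.1 (uniform ensemble); Mathlib `PMF.uniformOfFintype`] [cite: BogdanovTrevisan2006, §1.1 (uniform ensemble] -/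
noncomputable def uniformEnsemble : Ensemble := fun n =>
  (PMF.uniformOfFintype (List.Vector Bool n)).map List.Vector.toList

/-- The class `PSamp` of polynomial-time samplable ensembles.
[Bogdanov–Trevisan 2006, Def. 2.1] [cite: BogdanovTrevisan2006, Def. 2.1] -/
def PSamp : Set Ensemble := {D | D.IsPolySamplable}

/-! ### Distributional problems and classes -/

/-- A *distributional (decision) problem* `(L, D)`: a language `L ⊆ {0,1}*` together with an
ensemble `D` of input distributions. [Levin 1986; Bogdanov–Trevisan 2006, Def. 1.1/§2.1] [cite: Levin1986] -/
structure DistProblem where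
  /-- The language to be decided. -/
  lang : Language Bool
  /-- The ensemble of input distributions. -/
  dist : Ensemble

/-- `distClass C 𝒟`: the distributional class `(C, 𝒟) = {(L, D) | L ∈ C, D ∈ 𝒟}` of a
worst-case class `C` and a class of ensembles `𝒟` (e.g. `DistNP = distClass NP PSamp`,
`(NP, U) = distClass NP {uniformEnsemble}`). [Bogdanov–Trevisan 2006, §2.1 (Def. 2.3)] [cite: BogdanovTrevisan2006, §2.1 (Def. 2.3] -/
def distClass (C : Set (Language Bool)) (𝒟 : Set Ensemble) : Set DistProblem :=
  {Q | Q.lang ∈ C ∧ Q.dist ∈ 𝒟}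

/-- `distClass` is monotone in both arguments. [Bogdanov–Trevisan 2006, §2.1] [cite: BogdanovTrevisan2006, §2.1] -/
theorem distClass_mono {C C' : Set (Language Bool)} {𝒟 𝒟' : Set Ensemble} (hC : C ⊆ C')
    (h𝒟 : 𝒟 ⊆ 𝒟') : distClass C 𝒟 ⊆ distClass C' 𝒟' :=
  fun _ hQ => ⟨hC hQ.1, h𝒟 hQ.2⟩

/-- The class `DistNP = (NP, PSamp)` of distributional problems with an `NP` language and a
polynomial-time samplable ensemble. [Bogdanov–Trevisan 2006, Def. 2.3; Impagliazzo 1995, §2;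
Ben-David–Chor–Goldreich–Luby 1992] [cite: BogdanovTrevisan2006, Def. 2.3] -/
noncomputable def DistNP : Set DistProblem := distClass NP PSamp

/-! ### Input/output encodings for average-case algorithms -/

/-- Input encoding for parametrised algorithms: `(x, n) ↦ ⟨x, 1ⁿ⟩ = boolPair x (unaryEncodeNat
n)` (the algorithm is given the sample `x` and the distribution parameter `n` in unary).
[Bogdanov–Trevisan 2006, §2.1 ("`A(x; n)`"); H21 `boolPair`] [cite: BogdanovTrevisan2006, §2.1 (" A(x] -/
def paramEnc : List Bool × ℕ → List Bool := fun q => boolPair q.1 (unaryEncodeNat q.2)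

/-- Input encoding for heuristic *schemes*: `(x, n, m) ↦ ⟨x, ⟨1ⁿ, 1ᵐ⟩⟩`, where the error
parameter is `δ = 1/m`; thus "polynomial in `n/δ`" is "polynomial in `n + m`", i.e. in the
encoded input length (given `HasPolyLength`). [Bogdanov–Trevisan 2006, Def. 2.4
("`A(x; n, δ)` runs in time `poly(n/δ)`"); H21 `boolPair`] [cite: BogdanovTrevisan2006, Def. 2.4 (" A(x] -/
def schemeEnc : List Bool × ℕ × ℕ → List Bool := fun q =>
  boolPair q.1 (boolPair (unaryEncodeNat q.2.1) (unaryEncodeNat q.2.2))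

/-- Output encoding for errorless algorithms: `Option Bool` (`none` = the failure symbol `⊥`)
via G01's `Encoding.optionBool` of Mathlib's `encodingBoolBool` (`none ↦ [false]`,
`some b ↦ [true, b]`). [Bogdanov–Trevisan 2006, Def. 2.4 (output in `{0, 1, ⊥}`)] [cite: BogdanovTrevisan2006, Def. 2.4 (output in  {0  1  ⊥}] -/
def optBoolEnc : Option Bool → List Bool := (encodingBoolBool.optionBool).encode

/-! ### Errorless and heuristic classes -/

/-- `IsErrorlessFor A Q`: the parametrised `{0,1,⊥}`-valued algorithm `A` never gives a wrong
answer about `Q.lang` on the support of the ensemble — for every `n`, every `x ∈ supp Dₙ` and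
every `b`, `A x n = some b → b = [x ∈ L]`. Errorlessness is required **on the support only**,
exactly as in Bogdanov–Trevisan ("for every `n` and every `x ∈ supp Dₙ`, `A(x; n) ∈ {L(x), ⊥}`);
off-support behaviour is unconstrained (cf. `AvgPLevin`). Noncomputable (`Set.boolIndicator`).
[Bogdanov–Trevisan 2006, Def. 2.4 (i) ("errorless"), Def. 2.7] [cite: BogdanovTrevisan2006, Def. 2.4 (i] -/
noncomputable def IsErrorlessFor (A : List Bool → ℕ → Option Bool) (Q : DistProblem) : Prop :=
  ∀ n, ∀ x ∈ (Q.dist n).support, ∀ b, A x n = some b → b = Q.lang.boolIndicator x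

/-- `AvgDeltaP δ` (`Avg_δ P`): distributional problems admitting a deterministic polynomial-time
errorless heuristic *algorithm* with failure probability `δ`: `A(x, 1ⁿ) ∈ {0,1,⊥}` is
polynomial-time (in `|⟨x, 1ⁿ⟩|`), never wrong on `supp Dₙ`, and
`Pr_{x ∼ Dₙ}[A(x, 1ⁿ) = ⊥] ≤ δ n`. The parameter `δ` is unconstrained (BT): the condition at
`n` is unsatisfiable if `δ n < 0` and void if `δ n ≥ 1`. [Bogdanov–Trevisan 2006, Def. 2.7] [cite: BogdanovTrevisan2006, Def. 2.7] -/
noncomputable def AvgDeltaP (δ : ℕ → ℝ) : Set DistProblem :=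
  {Q | ∃ A : List Bool → ℕ → Option Bool,
    PolyTimeComputable paramEnc optBoolEnc (Function.uncurry A) ∧ IsErrorlessFor A Q ∧
      ∀ n, Q.dist.prob n {x | A x n = none} ≤ δ n}

/-- `AvgP`: distributional problems admitting an *errorless heuristic scheme* — a deterministic
algorithm `A(x, 1ⁿ, 1ᵐ) ∈ {0,1,⊥}` running in time polynomial in `|⟨x, 1ⁿ, 1ᵐ⟩|` that is never
wrong on `supp Dₙ` (`IsErrorlessFor`, BT Def. 2.4 (i)) and fails (`⊥`) with probability
`Pr_{x ∼ Dₙ}[A(x,1ⁿ,1ᵐ) = ⊥] ≤ 1/m` for every `m > 0`.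

This is Bogdanov–Trevisan's characterisation (Prop. 2.6 / Impagliazzo 1995) of Levin's class of
problems solvable in average polynomial time, taken here as the *definition*
(theorem-as-definition, cf. G01's `ZPP`); Levin's form is `AvgPLevin` and the equivalence is
`mem_AvgP_iff_mem_AvgPLevin`. "Polynomial in `|schemeEnc (x,n,m)|`" coincides with BT's
"polynomial in `n/δ`" exactly for ensembles with `Ensemble.HasPolyLength` (BT's standing
assumption; automatic on `PSamp`). [Bogdanov–Trevisan 2006, Def. 2.4–2.5, Prop. 2.6;
Impagliazzo 1995, §2; Levin 1986] [cite: BogdanovTrevisan2006, Def. 2.4–2.5  Prop. 2.6] -/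
noncomputable def AvgP : Set DistProblem :=
  {Q | ∃ A : List Bool → ℕ → ℕ → Option Bool,
    PolyTimeComputable schemeEnc optBoolEnc (fun q => A q.1 q.2.1 q.2.2) ∧
      (∀ m, IsErrorlessFor (fun x n => A x n m) Q) ∧
      ∀ n m, 0 < m → Q.dist.prob n {x | A x n m = none} ≤ 1 / m}

/-- `HeurDeltaP δ` (`Heur_δ P`): distributional problems admitting a deterministic
polynomial-time *heuristic algorithm* with error probability `δ`: `A(x, 1ⁿ) ∈ {0,1}` is
polynomial-time in `|⟨x, 1ⁿ⟩|` and `Pr_{x ∼ Dₙ}[A(x, 1ⁿ) ≠ [x ∈ L]] ≤ δ n`. As for `AvgDeltaP`,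
`δ` is unconstrained (unsatisfiable at `n` if `δ n < 0`, void if `δ n ≥ 1`).
[Bogdanov–Trevisan 2006, Def. 2.10] [cite: BogdanovTrevisan2006, Def. 2.10] -/
noncomputable def HeurDeltaP (δ : ℕ → ℝ) : Set DistProblem :=
  {Q | ∃ A : List Bool → ℕ → Bool,
    PolyTimeComputable paramEnc encodeBool (Function.uncurry A) ∧
      ∀ n, Q.dist.prob n {x | A x n ≠ Q.lang.boolIndicator x} ≤ δ n}

/-- `HeurP`: distributional problems admitting a *heuristic scheme* — a deterministic algorithm
`A(x, 1ⁿ, 1ᵐ) ∈ {0,1}` running in time polynomial in `|⟨x, 1ⁿ, 1ᵐ⟩|` with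
`Pr_{x ∼ Dₙ}[A(x,1ⁿ,1ᵐ) ≠ [x ∈ L]] ≤ 1/m` for every `m > 0`.
[Bogdanov–Trevisan 2006, Def. 2.9; Impagliazzo 1995, §2] [cite: BogdanovTrevisan2006, Def. 2.9] -/
noncomputable def HeurP : Set DistProblem :=
  {Q | ∃ A : List Bool → ℕ → ℕ → Bool,
    PolyTimeComputable schemeEnc encodeBool (fun q => A q.1 q.2.1 q.2.2) ∧
      ∀ n m, 0 < m → Q.dist.prob n {x | A x n m ≠ Q.lang.boolIndicator x} ≤ 1 / m}

/-- `AvgPLevin`: Levin's class of distributional problems decidable in *average polynomial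
time* — some TM2 machine `M` decides `L` on input `⟨x, 1ⁿ⟩` within `T x n` steps for every `x`
in the support of `Dₙ`, where `T` is polynomial on `D`-average (`Ensemble.IsPolyOnAverage`:
`𝔼_{x ∼ Dₙ}[T(x,n)^ε] = O(n)`). Halting with the correct answer is required **on the support
only** (off-support inputs have weight `0` in Levin's/BT's expectation; requiring it everywhere
would exclude `AvgP` problems whose language is undecidable off the support). By the halting
rule of `TimeBounds.lean`, `T x n` dominates `|⟨x, 1ⁿ⟩|` on the support.
[Levin 1986; Bogdanov–Trevisan 2006, Def. 2.2; Impagliazzo 1995, §2.2] [cite: Levin1986] -/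
noncomputable def AvgPLevin : Set DistProblem :=
  {Q | ∃ (M : Turing.TM2ComputableAux Bool Bool) (T : List Bool → ℕ → ℕ),
    (∀ n, ∀ x ∈ (Q.dist n).support,
      M.OutputsWithin (paramEnc (x, n)) (encodeBool (Q.lang.boolIndicator x)) (T x n)) ∧
    Q.dist.IsPolyOnAverage T}

/-! ### API -/

/-- The support of the uniform distribution `Uₙ` is exactly the set of strings of length `n`.
[Bogdanov–Trevisan 2006, §1.1; Mathlib `PMF.mem_support_map_iff`, `PMF.support_uniformOfFintype`] [cite: BogdanovTrevisan2006, §1.1] -/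
theorem mem_support_uniformEnsemble_iff (n : ℕ) (x : List Bool) :
    x ∈ (uniformEnsemble n).support ↔ x.length = n := by
  unfold uniformEnsemble
  rw [PMF.mem_support_map_iff]
  constructor
  · rintro ⟨v, -, rfl⟩
    exact v.toList_length
  · intro h
    exact ⟨⟨x, h⟩, by simp, rfl⟩

/-- The uniform ensemble has polynomially (indeed linearly) bounded support lengths.
[Bogdanov–Trevisan 2006, §2.1] [cite: BogdanovTrevisan2006, §2.1] -/
theorem hasPolyLength_uniformEnsemble : uniformEnsemble.HasPolyLength := by
  refine ⟨Polynomial.X, fun n x hx => ?_⟩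
  rw [(mem_support_uniformEnsemble_iff n x).1 hx, Polynomial.eval_X]

/-- A polynomial-time samplable ensemble has polynomially bounded support lengths: a
polynomial-time sampler on `1ⁿ` with polynomially many coins writes only polynomially many
output bits. [Bogdanov–Trevisan 2006, §2.1 (remark after Def. 2.1)] [cite: BogdanovTrevisan2006, §2.1 (remark after Def. 2.1] -/
def Ensemble.IsPolySamplable.hasPolyLength : Prop :=
  ∀ {D : Ensemble} (h : D.IsPolySamplable),
    D.HasPolyLength

/-- The uniform ensemble is polynomial-time samplable (output the first `n` coins).
[Bogdanov–Trevisan 2006, §2.1 (Def. 2.1, example)] [cite: BogdanovTrevisan2006, §2.1 (Def. 2.1  example] -/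
def uniformEnsemble_mem_PSamp : Prop :=
  uniformEnsemble ∈ PSamp

/-- Link to G01: the probability of an event under the uniform ensemble is G01's counting
probability `uniformProb n E = #{r ∈ {0,1}ⁿ | r ∈ E} / 2ⁿ`.
[H21 `uniformProb_eq_toOuterMeasure`; Mathlib `PMF.toOuterMeasure_map_apply`] [folklore] -/
theorem prob_uniformEnsemble (n : ℕ) (E : Set (List Bool)) :
    uniformEnsemble.prob n E = uniformProb n E := by
  rw [uniformProb_eq_toOuterMeasure, Ensemble.prob, uniformEnsemble,
    PMF.toOuterMeasure_map_apply]
  rfl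

/-- An errorless heuristic algorithm with failure probability `δ` yields a heuristic algorithm
with error probability `δ` (answer arbitrarily, say `0`, instead of `⊥`): `Avg_δP ⊆ Heur_δP`.
[Bogdanov–Trevisan 2006, §2.2 (remark after Def. 2.10)] [cite: BogdanovTrevisan2006, §2.2 (remark after Def. 2.10] -/
def AvgDeltaP_subset_HeurDeltaP : Prop :=
  ∀ (δ : ℕ → ℝ),
    AvgDeltaP δ ⊆ HeurDeltaP δ

/-- Errorless heuristic schemes are heuristic schemes: `AvgP ⊆ HeurP`.
[Bogdanov–Trevisan 2006, §2.2] [cite: BogdanovTrevisan2006, §2.2] -/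
def AvgP_subset_HeurP : Prop :=
  AvgP ⊆ HeurP

/-- Worst-case polynomial time is average polynomial time for every ensemble:
`(P, 𝒟) ⊆ AvgP` for any class of ensembles (ignore `1ⁿ, 1ᵐ` and never output `⊥`).
[Bogdanov–Trevisan 2006, §2.1] [cite: BogdanovTrevisan2006, §2.1] -/
def distClass_P_subset_AvgP : Prop :=
  distClass P Set.univ ⊆ AvgP

/-- Equivalence of the two definitions of average polynomial time (Impagliazzo 1995;
Bogdanov–Trevisan 2006, Prop. 2.6): for an ensemble whose support strings have polynomially
bounded length, `(L, D)` has an errorless heuristic scheme iff it is decidable in Levin's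
average polynomial time.

The hypothesis `HasPolyLength` is **necessary** and this is *not* a hypothesis-free `Iff`:
if `supp Dₙ` contains strings of unboundedly large length with heavy enough tails, then
`𝔼_{x ∼ Dₙ}[|x|^ε] = ∞` for every `ε > 0`, so no machine (which must at least read `x`) is
polynomial on average, while the trivial language `∅` lies in `AvgP` (answer `0` in time
`O(|input|)`); thus `∅ × D ∈ AvgP \ AvgPLevin`. Under `HasPolyLength`, "polynomial in
`|⟨x, 1ⁿ, 1ᵐ⟩|`" is "polynomial in `n·m = n/δ`", which is BT's formulation.
[Bogdanov–Trevisan 2006, Prop. 2.6; Impagliazzo 1995, §2.2; Levin 1986] [cite: BogdanovTrevisan2006, Prop. 2.6] -/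
def mem_AvgP_iff_mem_AvgPLevin : Prop :=
  ∀ {Q : DistProblem} (h : Q.dist.HasPolyLength),
    Q ∈ AvgP ↔ Q ∈ AvgPLevin

end Literature.Computability.MetaComplexity
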